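import Mathlib
import HarnessLib
import Literature.Analysis.FluidPDE.SuitableWeak
import Literature.Analysis.FluidPDE.SelfSimilar
import Literature.Analysis.FluidPDE.LocalTypeI
import Literature.Analysis.FluidPDE.NSBoundedMildOseen
import Literature.Analysis.FluidPDE.KNSSTypeIRateMildProofs
import Literature.Analysis.FluidPDE.OseenDuhamelLimits
import Literature.Analysis.FluidPDE.KatoSymmetryCovariance
import Literature.Analysis.FluidPDE.LocalTypeIReverseZoom
import Literature.Analysis.FluidPDE.LocalTypeICongr
import Summits.NavierStokesRegularity.NavierStokesRegularity.Theorems.RellichScarApexLocalisationApexOfDecaying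

/-!
# The translation/zoom-in hull of the class 𝒜(C,B) is closed under slice-wise locally uniform
# limits (stub `stub_hullClosed`, line decaying-ancient-bridge of crux RellichScar.ApexLocalisation)

The line works with the class 𝒜(C,B) of fields `M : ℝ → ℝ³ → ℝ³` (inlined as a conjunction in every
stub): continuous on the open backward slab `(-∞,0) × ℝ³`, weakly divergence-free slices, the
Oseen identity `M(t) = e^{(t-s)Δ}M(s) − B¹_s(M,M)(t)` for all `s < t < 0` (`heatExtension`,
`oseenDuhamel`), the bound `‖M‖ ≤ B`, the rate `‖M(t,x)‖ ≤ C/√(−t)` (`HasTypeITimeDecay C`), and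
suitable-weak data `(q, H)` on the slab with Albritton–Barker quantity `𝐈 < ⊤`.

`stub_hullClosed`: granted the ENGINE of the line (slab compactness of Type-I-bounded suitable
weak solutions, Albritton–Barker 2019 §3; tree theorem `slab_typeI_compactness`, here the first
hypothesis), every slice-wise locally uniform limit `N`, continuous on the open slab, of ADMISSIBLE
HULL IMAGES `M_k(t,y) = λ_k M(t_k + λ_k² t, x_k + λ_k y)` (`t_k ≤ 0`, `0 < λ_k ≤ 1`) of a member
`M ∈ 𝒜(C,B)` is again in 𝒜(C,B).  Conjunct by conjunct (KNSS 2009, Lemma 6.1-type bookkeeping):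

* §1 kinematics of hull images `M_k = λ_k • stPull (λ_k²) λ_k t_k x_k M`: continuity on the slab
  (`t_k ≤ 0` keeps image times negative), weakly divergence-free slices
  (`IsWeaklyDivFree.comp_sub_right`, `IsWeaklyDivFree.nsRescaleData`), the bound `B` (`λ_k ≤ 1`),
  the rate `C` (`t_k ≤ 0`), the Oseen identity (parabolic covariance `oseen_smul_stPull`);
* §2 limits: weak divergence-freeness passes to bounded pointwise limits (dominated convergence
  against a fixed `∇θ`); the Oseen identity passes to the limit
  (`tendsto_heatExtension_of_tendsto_of_bound`, `tendsto_oseenDuhamel_of_tendsto_of_bound`,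
  KNSS 2009 Lemma 4.1); an `L³_loc` limit is a.e. the pointwise limit (a.e.-convergent
  subsequences, ball by ball, `Q(0, n+1)` exhausting the slab);
* §3 suitable data: the transformed triples `(M_k, λ_k² q∘Φ_k, λ_k² H∘Φ_k)` are suitable weak on the
  slab with `𝐈 ≤ 𝐈(M)` (`zoom_isSuitableWeakSolutionOn`, `zoom_hasWeakSpatialGradientOn`,
  `abScaledSum_zoom_le_typeIBound`); the ENGINE gives `(u, p, H')` with `𝐈 ≤ 4 𝐈(M)` and
  `M_{σ j} → u` in `L³(Q(0,R))`; `u = N` a.e. on the slab, and `IsSuitableWeakSolutionOn.congr_ae`,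
  `HasWeakSpatialGradientOn.congr_ae`, `typeIBound_congr_ae` transfer the data to `N`.

The argument is that of the negative-side support file
`Theorems/ApexLocalisation/Negative/BridgeHullClosure.lean` (`inBridgeClass_hullLimit`), redone over
Literature imports and the sibling stub file `…ApexOfDecaying` (the negative file imports the
route's Theses file, which a closing Theorems file must not do).

## References

* G. Koch, N. Nadirashvili, G. Seregin, V. Šverák, Acta Math. 203 (2009) 83–105, §1 (1.2),
  Lemma 4.1, Lemma 6.1. [KNSS2009, KochNadirashviliSereginSverak2009]
* D. Albritton, T. Barker, J. Math. Fluid Mech. 21 (2019) = arXiv:1811.00502, Lemma 2.2,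
  Prop. 2.3, §3. [AlbrittonBarker2019]
-/

-- the summit and its single sub-problem share the name (CONVENTIONS §1), as in every Theorems file
set_option linter.dupNamespace false

namespace Summit.NavierStokesRegularity.NavierStokesRegularity.Theorems.RellichScarApexLocalisation

open MeasureTheory Set Function Metric Filter Topology TopologicalSpace
open scoped ENNReal NNReal
open Literature.Analysis Literature.Analysis.FluidPDE

local notation "E³" => EuclideanSpace ℝ (Fin 3)

open scoped RealInnerProductSpace

/-! ### §1 Kinematics of admissible hull images `λ • stPull (λ²) λ t₀ x₀ M` -/

/-- **A hull image of a slab-continuous field is continuous on the open slab**: for `t₀ ≤ 0` and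
`λ > 0` the affine map `(t, y) ↦ (t₀ + λ² t, x₀ + λ y)` maps `(-∞,0) × ℝ³` into itself. -/
theorem continuousOn_hullImage {M : ℝ → E³ → E³}
    (hcont : ContinuousOn (uncurry M) (Iio (0 : ℝ) ×ˢ univ))
    {x₀ : E³} {t₀ lam : ℝ} (ht₀ : t₀ ≤ 0) (hl0 : 0 < lam) :
    ContinuousOn (uncurry (lam • stPull (lam ^ 2) lam t₀ x₀ M)) (Iio (0 : ℝ) ×ˢ univ) := by
  have e : uncurry (lam • stPull (lam ^ 2) lam t₀ x₀ M) =
      fun w => lam • uncurry M (stAffine (lam ^ 2) lam t₀ x₀ w) := by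
    funext w; rfl
  rw [e]
  refine ContinuousOn.const_smul (hcont.comp (continuous_stAffine _ _ _ _).continuousOn ?_) lam
  rintro ⟨t, y⟩ ⟨ht, -⟩
  refine ⟨show t₀ + lam ^ 2 * t < 0 from ?_, mem_univ _⟩
  nlinarith [mul_neg_of_pos_of_neg (pow_pos hl0 2) (mem_Iio.1 ht)]

/-- **Slices of hull images of a field with weakly divergence-free slices are weakly divergence
free** (translation covariance `IsWeaklyDivFree.comp_sub_right` and scaling covariance
`IsWeaklyDivFree.nsRescaleData` of the condition `∫ ⟪u, ∇θ⟫ = 0`). -/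
theorem isWeaklyDivFree_hullImage {M : ℝ → E³ → E³} (hdiv : ∀ t < 0, IsWeaklyDivFree (M t))
    {x₀ : E³} {t₀ lam : ℝ} (ht₀ : t₀ ≤ 0) (hl0 : 0 < lam) {t : ℝ} (ht : t < 0) :
    IsWeaklyDivFree ((lam • stPull (lam ^ 2) lam t₀ x₀ M) t) := by
  have htime : t₀ + lam ^ 2 * t < 0 := by nlinarith [mul_neg_of_pos_of_neg (pow_pos hl0 2) ht]
  have h := ((hdiv _ htime).comp_sub_right (-x₀)).nsRescaleData hl0
  have e : (lam • stPull (lam ^ 2) lam t₀ x₀ M) t =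
      nsRescaleData lam (fun w => M (t₀ + lam ^ 2 * t) (w - -x₀)) := by
    funext y
    simp only [Pi.smul_apply, stPull_apply, nsRescaleData, sub_neg_eq_add, add_comm x₀]
  rwa [e]

/-- **The backward slab lies in its own pull-back under an admissible hull map** (`t₀ ≤ 0`):
`t < 0 ⟹ t₀ + λ² t < 0`. -/
theorem slab_le_stPreimage_hullImage {t₀ : ℝ} (ht₀ : t₀ ≤ 0) {lam : ℝ} (hl0 : 0 < lam) (x₀ : E³) :
    (slab E³ (Iio 0) isOpen_Iio) ≤
      stPreimage (lam ^ 2) lam t₀ x₀ (slab E³ (Iio 0) isOpen_Iio) := by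
  intro w hw
  have hw' : w.1 < 0 := by simpa [mem_slab] using hw
  show stAffine (lam ^ 2) lam t₀ x₀ w ∈ (slab E³ (Iio 0) isOpen_Iio : Opens (ℝ × E³))
  rw [mem_slab, stAffine_fst]
  show t₀ + lam ^ 2 * w.1 < 0
  nlinarith [mul_neg_of_pos_of_neg (pow_pos hl0 2) hw']

/-- **A parabolic ball inside the backward slab has a non-positive top time**: if
`Q(z, r) ⊆ (-∞,0) × ℝ³` with `r > 0` then `z.1 ≤ 0` (otherwise `(z.1 − ε, z.2) ∈ Q(z, r)` has
positive time for small `ε > 0`). -/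
theorem fst_nonpos_of_parabolicCylinder_subset_lowerHalf {r : ℝ} (hr : 0 < r) {z : ℝ × E³}
    (h : parabolicCylinder r z ⊆ Iio (0 : ℝ) ×ˢ (univ : Set E³)) : z.1 ≤ 0 := by
  by_contra hz
  push Not at hz
  have hε1 : min (r ^ 2 / 2) (z.1 / 2) ≤ r ^ 2 / 2 := min_le_left _ _
  have hε2 : min (r ^ 2 / 2) (z.1 / 2) ≤ z.1 / 2 := min_le_right _ _
  have hε0 : 0 < min (r ^ 2 / 2) (z.1 / 2) := lt_min (by positivity) (by linarith)
  have hw : (z.1 - min (r ^ 2 / 2) (z.1 / 2), z.2) ∈ parabolicCylinder r z := by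
    rw [mem_parabolicCylinder]
    exact ⟨⟨by dsimp only; nlinarith [sq_nonneg r], by dsimp only; linarith⟩, by simpa using hr⟩
  have : z.1 - min (r ^ 2 / 2) (z.1 / 2) < 0 := (h hw).1
  linarith

/-- **Admissible hull images keep the bound `B`** (`λ ≤ 1`; `0 ≤ B` is forced by the hypothesis). -/
theorem norm_hullImage_le {M : ℝ → E³ → E³} {B : ℝ} (hB : ∀ t < 0, ∀ x : E³, ‖M t x‖ ≤ B)
    {x₀ : E³} {t₀ lam : ℝ} (ht₀ : t₀ ≤ 0) (hl0 : 0 < lam) (hl1 : lam ≤ 1)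
    (t : ℝ) (ht : t < 0) (y : E³) : ‖(lam • stPull (lam ^ 2) lam t₀ x₀ M) t y‖ ≤ B := by
  have htime : t₀ + lam ^ 2 * t < 0 := by nlinarith [mul_neg_of_pos_of_neg (pow_pos hl0 2) ht]
  rw [smul_stPull_apply, norm_smul, Real.norm_of_nonneg hl0.le, ← one_mul B]
  exact mul_le_mul hl1 (hB _ htime (x₀ + lam • y)) (norm_nonneg _) zero_le_one

/-- **Admissible hull images keep the rate with the same constant** (`t₀ ≤ 0`:
`λ C/√(−t₀ − λ²t) ≤ λ C/(λ√(−t)) = C/√(−t)`; KNSS 2009, (1.4) is scale invariant and improves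
under past shifts). -/
theorem hasTypeITimeDecay_hullImage {M : ℝ → E³ → E³} {C : ℝ} (hC : HasTypeITimeDecay C M)
    {x₀ : E³} {t₀ lam : ℝ} (ht₀ : t₀ ≤ 0) (hl0 : 0 < lam) :
    HasTypeITimeDecay C (lam • stPull (lam ^ 2) lam t₀ x₀ M) := by
  intro t ht y
  have htime : t₀ + lam ^ 2 * t < 0 := by nlinarith [mul_neg_of_pos_of_neg (pow_pos hl0 2) ht]
  have hb := hC _ htime (x₀ + lam • y)
  have hs : 0 < Real.sqrt (-(t₀ + lam ^ 2 * t)) := Real.sqrt_pos.2 (by linarith)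
  have hC0 : 0 ≤ C := by
    have := (norm_nonneg _).trans hb
    exact (div_nonneg_iff.1 this).elim (fun h => h.1) fun h => absurd h.2 (not_le.2 hs)
  have hpos : 0 < lam * Real.sqrt (-t) := mul_pos hl0 (Real.sqrt_pos.2 (by linarith))
  have hsl : lam * Real.sqrt (-t) ≤ Real.sqrt (-(t₀ + lam ^ 2 * t)) := by
    rw [show lam * Real.sqrt (-t) = Real.sqrt (lam ^ 2 * (-t)) by
      rw [Real.sqrt_mul (sq_nonneg _), Real.sqrt_sq hl0.le]]
    exact Real.sqrt_le_sqrt (by nlinarith)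
  rw [smul_stPull_apply, norm_smul, Real.norm_of_nonneg hl0.le]
  calc lam * ‖M (t₀ + lam ^ 2 * t) (x₀ + lam • y)‖
      ≤ lam * (C / (lam * Real.sqrt (-t))) :=
        mul_le_mul_of_nonneg_left (hb.trans (div_le_div_of_nonneg_left hC0 hpos hsl)) hl0.le
    _ = C / Real.sqrt (-t) := by field_simp

/-- **Admissible hull images keep the Oseen integral identity between negative times** (parabolic
and translation covariance of `e^{σΔ}` and of the Duhamel term, `oseen_smul_stPull`; the image
times `t₀ + λ² s < t₀ + λ² t` stay negative as `t₀ ≤ 0`; KNSS 2009, §1 (1.2)). -/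
theorem oseen_hullImage {M : ℝ → E³ → E³}
    (hoseen : ∀ s t : ℝ, s < t → t < 0 → ∀ x : E³,
      M t x = UnboundedOperators.heatExtension (M s) (t - s) x - oseenDuhamel 1 s M M t x)
    {x₀ : E³} {t₀ lam : ℝ} (ht₀ : t₀ ≤ 0) (hl0 : 0 < lam) {s t : ℝ} (hst : s < t) (ht : t < 0)
    (x : E³) :
    (lam • stPull (lam ^ 2) lam t₀ x₀ M) t x =
      UnboundedOperators.heatExtension ((lam • stPull (lam ^ 2) lam t₀ x₀ M) s) (t - s) x -
        oseenDuhamel 1 s (lam • stPull (lam ^ 2) lam t₀ x₀ M) (lam • stPull (lam ^ 2) lam t₀ x₀ M)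
          t x := by
  have h1 : t₀ + lam ^ 2 * s < t₀ + lam ^ 2 * t := by nlinarith [pow_pos hl0 2]
  have h2 : t₀ + lam ^ 2 * t < 0 := by nlinarith [mul_neg_of_pos_of_neg (pow_pos hl0 2) ht]
  exact oseen_smul_stPull hl0 t₀ x₀ hst (fun X => hoseen _ _ h1 h2 X) x

/-! ### §2 Passing to slice-wise pointwise limits on the slab -/

/-- **Every slice of a pointwise limit of uniformly bounded slab-continuous fields with weakly
divergence-free slices is weakly divergence free** (dominated convergence in
`∫ ⟪V_k(t), ∇θ⟫ = 0` against the fixed compactly supported `∇θ`; KNSS 2009, proof of Lemma 6.1). -/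
theorem isWeaklyDivFree_of_tendsto_slab {B : ℝ} {V : ℕ → ℝ → E³ → E³} {v : ℝ → E³ → E³}
    (hdiv : ∀ k, ∀ t < 0, IsWeaklyDivFree (V k t))
    (hcont : ∀ k, ContinuousOn (uncurry (V k)) (Iio (0 : ℝ) ×ˢ univ))
    (hbd : ∀ k, ∀ t < 0, ∀ x, ‖V k t x‖ ≤ B)
    (hlim : ∀ t < 0, ∀ x, Tendsto (fun k => V k t x) atTop (𝓝 (v t x))) :
    ∀ t < 0, IsWeaklyDivFree (v t) := by
  intro t ht0 θ hθ
  have hθ1 : ContDiff ℝ 1 θ := contDiff_infty.1 hθ.contDiff 1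
  have hgc : HasCompactSupport (gradient θ) := by
    have : gradient θ = (fun L => (InnerProductSpace.toDual ℝ E³).symm L) ∘ fderiv ℝ θ := rfl
    rw [this]
    exact (hθ.hasCompactSupport.fderiv (𝕜 := ℝ)).comp_left (by simp)
  have hθi : Integrable (fun x => B * ‖gradient θ x‖) volume :=
    (((continuous_gradient_of_contDiff hθ1).integrable_of_hasCompactSupport hgc).norm).const_mul B
  have hlimθ : Tendsto (fun k => ∫ x, ⟪V k t x, gradient θ x⟫) atTop
      (𝓝 (∫ x, ⟪v t x, gradient θ x⟫)) := by
    refine tendsto_integral_filter_of_dominated_convergence (fun x => B * ‖gradient θ x‖)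
      ?_ ?_ hθi (Eventually.of_forall fun x => (hlim t ht0 x).inner tendsto_const_nhds)
    · refine Eventually.of_forall fun k => ?_
      have hsl : Continuous (V k t) :=
        ((hcont k).comp_continuous (Continuous.prodMk_right t) fun x => ⟨ht0, mem_univ x⟩)
      exact (hsl.inner (continuous_gradient_of_contDiff hθ1)).aestronglyMeasurable
    · refine Eventually.of_forall fun k => Eventually.of_forall fun x => ?_
      exact (norm_inner_le_norm _ _).trans
        (mul_le_mul_of_nonneg_right (hbd k t ht0 x) (norm_nonneg _))
  have hzero : ∀ k, ∫ x, ⟪V k t x, gradient θ x⟫ = 0 := fun k => hdiv k t ht0 θ hθ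
  simp_rw [hzero] at hlimθ
  exact tendsto_nhds_unique hlimθ tendsto_const_nhds

/-- **The Oseen integral identity passes to bounded slice-wise pointwise limits on the slab**
(KNSS 2009, Lemma 4.1 / proof of Lemma 6.1): if slab-continuous fields `V_k`, bounded by `B` and
satisfying `V_k(t) = e^{(t-s)Δ}V_k(s) − B¹_s(V_k,V_k)(t)` for all `s < t < 0`, converge pointwise at
every point of the open slab to a slab-continuous `v`, then `v` satisfies the same identity
(`tendsto_heatExtension_of_tendsto_of_bound`, `tendsto_oseenDuhamel_of_tendsto_of_bound`). -/
theorem oseen_of_tendsto_slab {B : ℝ} {V : ℕ → ℝ → E³ → E³} {v : ℝ → E³ → E³}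
    (hoseen : ∀ k, ∀ s t : ℝ, s < t → t < 0 → ∀ x : E³,
      V k t x = UnboundedOperators.heatExtension (V k s) (t - s) x -
        oseenDuhamel 1 s (V k) (V k) t x)
    (hcont : ∀ k, ContinuousOn (uncurry (V k)) (Iio (0 : ℝ) ×ˢ univ))
    (hvcont : ContinuousOn (uncurry v) (Iio (0 : ℝ) ×ˢ univ))
    (hbd : ∀ k, ∀ t < 0, ∀ x, ‖V k t x‖ ≤ B)
    (hlim : ∀ t < 0, ∀ x, Tendsto (fun k => V k t x) atTop (𝓝 (v t x))) :
    ∀ s t : ℝ, s < t → t < 0 → ∀ x : E³,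
      v t x = UnboundedOperators.heatExtension (v s) (t - s) x - oseenDuhamel 1 s v v t x := by
  intro s t hst ht x
  have hs : s < 0 := hst.trans ht
  have hB0 : 0 ≤ B := (norm_nonneg _).trans (hbd 0 s hs x)
  have hVslice : ∀ k, ∀ τ < 0, Continuous (V k τ) := fun k τ hτ =>
    (hcont k).comp_continuous (Continuous.prodMk_right τ) fun y => ⟨hτ, mem_univ y⟩
  have h2 : Tendsto (fun k => UnboundedOperators.heatExtension (V k s) (t - s) x) atTop
      (𝓝 (UnboundedOperators.heatExtension (v s) (t - s) x)) :=
    tendsto_heatExtension_of_tendsto_of_bound (fun k => (hVslice k s hs).aestronglyMeasurable)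
      (fun k z => hbd k s hs z) (hlim s hs) (sub_pos.2 hst) x
  have hsub : Ioo s t ×ˢ (univ : Set E³) ⊆ Iio (0 : ℝ) ×ˢ univ :=
    prod_mono (fun τ hτ => hτ.2.trans ht) subset_rfl
  have hmeas : MeasurableSet (Ioo s t ×ˢ (univ : Set E³)) :=
    measurableSet_Ioo.prod MeasurableSet.univ
  have h3 : Tendsto (fun k => oseenDuhamel 1 s (V k) (V k) t x) atTop
      (𝓝 (oseenDuhamel 1 s v v t x)) :=
    tendsto_oseenDuhamel_of_tendsto_of_bound one_pos hB0 hst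
      (fun k => ((hcont k).mono hsub).aestronglyMeasurable hmeas)
      ((hvcont.mono hsub).aestronglyMeasurable hmeas)
      (fun k τ hτ y => hbd k τ (hτ.2.trans ht) y) (fun τ hτ y => hlim τ (hτ.2.trans ht) y) x
  have h4 : Tendsto (fun k => V k t x) atTop
      (𝓝 (UnboundedOperators.heatExtension (v s) (t - s) x - oseenDuhamel 1 s v v t x)) :=
    (h2.sub h3).congr fun k => (hoseen k s t hst ht x).symm
  exact tendsto_nhds_unique (hlim t ht x) h4

/-- **Identification of the `L³_loc` limit with the pointwise limit.** If measurable fields `V_j`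
converge to `u` in `L³(Q(0, n+1))` for every `n` and pointwise at every point of the open slab to
`v`, then `u = v` almost everywhere on the slab (a.e.-convergent subsequences of the `L³`-convergent
ones, ball by ball; uniqueness of limits; the balls `Q(0, n+1)` exhaust the slab). -/
theorem ae_eq_slab_of_tendsto_eLpNorm_of_tendsto {V : ℕ → ℝ → E³ → E³} {u v : ℝ → E³ → E³}
    (hVm : ∀ j, AEStronglyMeasurable (uncurry (V j))
      (volume.restrict (Iio (0 : ℝ) ×ˢ (univ : Set E³))))
    (hum : AEStronglyMeasurable (uncurry u) (volume.restrict (Iio (0 : ℝ) ×ˢ (univ : Set E³))))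
    (hL3 : ∀ n : ℕ, Tendsto (fun j => eLpNorm (uncurry (V j) - uncurry u) 3
      (volume.restrict (parabolicCylinder ((n : ℝ) + 1) (0 : ℝ × E³)))) atTop (𝓝 0))
    (hpt : ∀ t < 0, ∀ x, Tendsto (fun j => V j t x) atTop (𝓝 (v t x))) :
    ∀ᵐ w ∂(volume.restrict (Iio (0 : ℝ) ×ˢ (univ : Set E³))), uncurry u w = uncurry v w := by
  have hball : ∀ n : ℕ, ∀ᵐ w ∂(volume.restrict (parabolicCylinder ((n : ℝ) + 1) (0 : ℝ × E³))),
      uncurry u w = uncurry v w := by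
    intro n
    set Q : Set (ℝ × E³) := parabolicCylinder ((n : ℝ) + 1) (0 : ℝ × E³) with hQ
    have hQslab : Q ⊆ Iio (0 : ℝ) ×ˢ (univ : Set E³) := parabolicCylinder_origin_subset_slab _
    have hQmeas : MeasurableSet Q := (isOpen_parabolicCylinder _ _).measurableSet
    have hvm : ∀ j, AEStronglyMeasurable (uncurry (V j)) (volume.restrict Q) := fun j =>
      (hVm j).mono_measure (Measure.restrict_mono hQslab le_rfl)
    have hum' : AEStronglyMeasurable (uncurry u) (volume.restrict Q) :=
      hum.mono_measure (Measure.restrict_mono hQslab le_rfl)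
    have hTIM : TendstoInMeasure (volume.restrict Q) (fun j => uncurry (V j)) atTop (uncurry u) :=
      tendstoInMeasure_of_tendsto_eLpNorm (by norm_num) hvm hum' (hL3 n)
    obtain ⟨ns, hns, hae⟩ := hTIM.exists_seq_tendsto_ae
    filter_upwards [hae, ae_restrict_mem hQmeas] with w hw hwQ
    have hw1 : w.1 < 0 := (hQslab hwQ).1
    have h2 : Tendsto (fun i => uncurry (V (ns i)) w) atTop (𝓝 (uncurry v w)) :=
      (hpt w.1 hw1 w.2).comp hns.tendsto_atTop
    exact tendsto_nhds_unique hw h2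
  exact ae_restrict_of_ae_restrict_of_subset lowerHalf_subset_iUnion_parabolicCylinder
    ((ae_restrict_iUnion_iff _ _).2 hball)

/-! ### §3 The stub -/

/-- **The translation/zoom-in hull of 𝒜(C,B) is closed under slice-wise locally uniform limits**
(stub `stub_hullClosed` of line decaying-ancient-bridge).  Granted the slab compactness ENGINE
(Albritton–Barker 2019, Lemma 2.2 + Prop. 2.3 exhausted to the slab), if `M ∈ 𝒜(C,B)` and the
admissible hull images `λ_k M(t_k + λ_k² t, x_k + λ_k y)` (`t_k ≤ 0`, `0 < λ_k ≤ 1`) converge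
locally uniformly on every negative time slice to a field `N` continuous on the open slab, then
`N ∈ 𝒜(C,B)` (KNSS 2009, Lemma 6.1-type closure; the suitable data of `N` come from the ENGINE run
on the transformed suitable triples and the a.e. identification of its `L³_loc` limit with `N`). -/
theorem stub_hullClosed :
    (∀ (I : ℝ≥0∞) (v : ℕ → ℝ → E³ → E³) (q : ℕ → ℝ → E³ → ℝ) (G : ℕ → ℝ → E³ → E³ →L[ℝ] E³),
      I < ⊤ →
      (∀ k, IsSuitableWeakSolutionOn (slab E³ (Iio 0) isOpen_Iio) 1 0 (v k) (q k)) →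
      (∀ k, HasWeakSpatialGradientOn (slab E³ (Iio 0) isOpen_Iio) (v k) (G k)) →
      (∀ k, typeIBound (Iio (0 : ℝ) ×ˢ univ) (v k) (q k) (G k) ≤ I) →
      ∃ (u : ℝ → E³ → E³) (p : ℝ → E³ → ℝ) (H : ℝ → E³ → E³ →L[ℝ] E³) (σ : ℕ → ℕ),
        StrictMono σ ∧
        IsSuitableWeakSolutionOn (slab E³ (Iio 0) isOpen_Iio) 1 0 u p ∧
        HasWeakSpatialGradientOn (slab E³ (Iio 0) isOpen_Iio) u H ∧
        typeIBound (Iio (0 : ℝ) ×ˢ univ) u p H ≤ 4 * I ∧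
        (∀ R : ℝ, 0 < R → Tendsto (fun j => eLpNorm (uncurry (v (σ j)) - uncurry u) 3
          (volume.restrict (parabolicCylinder R (0 : ℝ × E³)))) atTop (𝓝 0)) ∧
        ((∀ R : ℝ, 0 < R → limsup (fun j => eLpNorm (uncurry (v (σ j))) ⊤
            (volume.restrict (parabolicCylinder R (0 : ℝ × E³)))) atTop = ⊤) →
          IsBackwardSingularPoint u 0)) →
    ∀ (C B : ℝ) (M : ℝ → E³ → E³) (xk : ℕ → E³) (tk : ℕ → ℝ) (lk : ℕ → ℝ) (N : ℝ → E³ → E³),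
      (ContinuousOn (uncurry M) (Iio (0 : ℝ) ×ˢ univ) ∧
        (∀ t < 0, IsWeaklyDivFree (M t)) ∧
        (∀ s t : ℝ, s < t → t < 0 → ∀ x : E³,
          M t x = UnboundedOperators.heatExtension (M s) (t - s) x - oseenDuhamel 1 s M M t x) ∧
        (∀ t < 0, ∀ x : E³, ‖M t x‖ ≤ B) ∧
        HasTypeITimeDecay C M ∧
        (∃ (q : ℝ → E³ → ℝ) (H : ℝ → E³ → E³ →L[ℝ] E³),
          IsSuitableWeakSolutionOn (slab E³ (Iio 0) isOpen_Iio) 1 0 M q ∧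
          HasWeakSpatialGradientOn (slab E³ (Iio 0) isOpen_Iio) M H ∧
          typeIBound (Iio (0 : ℝ) ×ˢ univ) M q H < ⊤)) →
      (∀ k, tk k ≤ 0 ∧ 0 < lk k ∧ lk k ≤ 1) →
      (∀ t < 0, TendstoLocallyUniformly
        (fun k (y : E³) => lk k • M (tk k + lk k ^ 2 * t) (xk k + lk k • y)) (N t) atTop) →
      ContinuousOn (uncurry N) (Iio (0 : ℝ) ×ˢ univ) →
      (ContinuousOn (uncurry N) (Iio (0 : ℝ) ×ˢ univ) ∧
        (∀ t < 0, IsWeaklyDivFree (N t)) ∧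
        (∀ s t : ℝ, s < t → t < 0 → ∀ x : E³,
          N t x = UnboundedOperators.heatExtension (N s) (t - s) x - oseenDuhamel 1 s N N t x) ∧
        (∀ t < 0, ∀ x : E³, ‖N t x‖ ≤ B) ∧
        HasTypeITimeDecay C N ∧
        (∃ (q : ℝ → E³ → ℝ) (H : ℝ → E³ → E³ →L[ℝ] E³),
          IsSuitableWeakSolutionOn (slab E³ (Iio 0) isOpen_Iio) 1 0 N q ∧
          HasWeakSpatialGradientOn (slab E³ (Iio 0) isOpen_Iio) N H ∧
          typeIBound (Iio (0 : ℝ) ×ˢ univ) N q H < ⊤)) := by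
  intro hE C B M xk tk lk N hM hadm hconv hNcont
  obtain ⟨hcont, hdiv, hoseen, hB, hC, q, H, hsws, hgrad, hI⟩ := hM
  -- the hull images as zooms `V k = λ_k • stPull (λ_k²) λ_k t_k x_k M`
  set V : ℕ → ℝ → E³ → E³ := fun k => lk k • stPull (lk k ^ 2) (lk k) (tk k) (xk k) M
  have hpt : ∀ t < 0, ∀ y : E³, Tendsto (fun k => V k t y) atTop (𝓝 (N t y)) :=
    fun t ht y => (tendstoLocallyUniformlyOn_univ.2 (hconv t ht)).tendsto_at (mem_univ y)
  have hVcont : ∀ k, ContinuousOn (uncurry (V k)) (Iio (0 : ℝ) ×ˢ univ) := fun k =>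
    continuousOn_hullImage hcont (hadm k).1 (hadm k).2.1
  have hVB : ∀ k, ∀ t < 0, ∀ y : E³, ‖V k t y‖ ≤ B := fun k t ht y =>
    norm_hullImage_le hB (hadm k).1 (hadm k).2.1 (hadm k).2.2 t ht y
  have hVC : ∀ k, HasTypeITimeDecay C (V k) := fun k =>
    hasTypeITimeDecay_hullImage hC (hadm k).1 (hadm k).2.1
  have hVdiv : ∀ k, ∀ t < 0, IsWeaklyDivFree (V k t) := fun k t ht =>
    isWeaklyDivFree_hullImage hdiv (hadm k).1 (hadm k).2.1 ht
  have hVoseen : ∀ k (s t : ℝ), s < t → t < 0 → ∀ x : E³,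
      V k t x = UnboundedOperators.heatExtension (V k s) (t - s) x -
        oseenDuhamel 1 s (V k) (V k) t x := fun k s t hst ht x =>
    oseen_hullImage hoseen (hadm k).1 (hadm k).2.1 hst ht x
  -- (i)–(v): continuity (hypothesis), divergence, Oseen identity, bound, rate
  have hNdiv : ∀ t < 0, IsWeaklyDivFree (N t) :=
    isWeaklyDivFree_of_tendsto_slab hVdiv hVcont hVB hpt
  have hNoseen : ∀ s t : ℝ, s < t → t < 0 → ∀ x : E³,
      N t x = UnboundedOperators.heatExtension (N s) (t - s) x - oseenDuhamel 1 s N N t x :=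
    oseen_of_tendsto_slab hVoseen hVcont hNcont hVB hpt
  have hNB : ∀ t < 0, ∀ x : E³, ‖N t x‖ ≤ B := fun t ht x =>
    le_of_tendsto' (hpt t ht x).norm fun k => hVB k t ht x
  have hNC : HasTypeITimeDecay C N := fun t ht x =>
    le_of_tendsto' (hpt t ht x).norm fun k => hVC k t ht x
  -- (vi) suitable data with `𝐈 < ⊤`: the ENGINE on the transformed suitable triples
  set qk : ℕ → ℝ → E³ → ℝ := fun k => lk k ^ 2 • stPull (lk k ^ 2) (lk k) (tk k) (xk k) q
  set Gk : ℕ → ℝ → E³ → E³ →L[ℝ] E³ :=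
    fun k => lk k ^ 2 • stPull (lk k ^ 2) (lk k) (tk k) (xk k) H
  have hle : ∀ k, (slab E³ (Iio 0) isOpen_Iio) ≤
      stPreimage (lk k ^ 2) (lk k) (tk k) (xk k) (slab E³ (Iio 0) isOpen_Iio) := fun k =>
    slab_le_stPreimage_hullImage (hadm k).1 (hadm k).2.1 _
  have hswsk : ∀ k, IsSuitableWeakSolutionOn (slab E³ (Iio 0) isOpen_Iio) 1 0 (V k) (qk k) :=
    fun k => (zoom_isSuitableWeakSolutionOn hsws (hadm k).2.1 (tk k) (xk k)).of_le (hle k)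
  have hgradk : ∀ k, HasWeakSpatialGradientOn (slab E³ (Iio 0) isOpen_Iio) (V k) (Gk k) :=
    fun k => (zoom_hasWeakSpatialGradientOn hgrad (hadm k).2.1 (tk k) (xk k)).mono (hle k)
  set I := typeIBound (Iio (0 : ℝ) ×ˢ (univ : Set E³)) M q H
  have hIk : ∀ k, typeIBound (Iio (0 : ℝ) ×ˢ univ) (V k) (qk k) (Gk k) ≤ I := fun k =>
    typeIBound_le_iff.2 fun r hr z hz =>
      abScaledSum_zoom_le_typeIBound (hadm k).2.1 (hadm k).1 (xk k) hr
        (fst_nonpos_of_parabolicCylinder_subset_lowerHalf hr hz)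
  obtain ⟨u', p', H', σ, hσ, hsws', hgrad', hI', hconv', -⟩ := hE I V qk Gk hI hswsk hgradk hIk
  -- identification `u' = N` a.e. on the slab
  have hae : ∀ᵐ w ∂(volume.restrict (Iio (0 : ℝ) ×ˢ (univ : Set E³))),
      uncurry u' w = uncurry N w :=
    ae_eq_slab_of_tendsto_eLpNorm_of_tendsto (V := fun j => V (σ j))
      (fun j => (hgradk (σ j)).locallyIntegrableOn.aestronglyMeasurable)
      hgrad'.locallyIntegrableOn.aestronglyMeasurable
      (fun n => hconv' ((n : ℝ) + 1) (by positivity))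
      (fun t ht x => (hpt t ht x).comp hσ.tendsto_atTop)
  have hae' : ∀ᵐ w ∂(volume.restrict
      ((slab E³ (Iio 0) isOpen_Iio : Opens (ℝ × E³)) : Set (ℝ × E³))),
      uncurry u' w = uncurry N w := by
    rw [coe_slab]
    exact hae
  refine ⟨hNcont, hNdiv, hNoseen, hNB, hNC, p', H',
    hsws'.congr_ae hae' (ae_of_all _ fun _ => rfl), hgrad'.congr_ae hae', ?_⟩
  rw [← typeIBound_congr_ae hae]
  exact lt_of_le_of_lt hI' (ENNReal.mul_lt_top (by simp) hI)

end Summit.NavierStokesRegularity.NavierStokesRegularity.Theorems.RellichScarApexLocalisation
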